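import Summits.CriticalPhenomena.PercolationContinuityZ3.Theses.PercEventualDensity
import Summits.CriticalPhenomena.PercolationContinuityZ3.Theorems.SomeScaleDensity.Negative.ThetaPosLoadBearing

/-!
# Birth skeleton (BC3) for the crux `SomeScaleDensity` (stmt-CriticalPhenomena-17919)

Route `route-CriticalPhenomena-PercEventualDensity` (sub-problem `PercolationContinuityZ3`), crux decl
`Summit.CriticalPhenomena.PercolationContinuityZ3.Theses.PercEventualDensity.SomeScaleDensity` (rank 2):
for every `p` with `θ(p) > 0` there is `t > 0` such that with positive `P_p`-probability the origin's
IN-BALL cluster `C^m(0) = {v ∈ B_m : 0 ↔ v inside B_m}` (`B_m = box 3 m = [-m,m]³`) satisfies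
`|C^m(0)| ≥ t·|B_m|` for infinitely many `m` (SDV). A theorem for `p > p_c` (Pisztora coarse graining);
at a hypothetical percolating `p_c(ℤ³)` it is exactly the negation of the SHATTERED jump branch.

THE LINE — "a box giant somewhere, at some scales ⟹ the origin's share, at infinitely many scales".
Work at ONE parameter `p` at a time and in finite volume. Two finite-size events at scale `N`
(all clusters are IN-BOX clusters of `ω` restricted to the box, as in the crux):

* the BOX-GIANT event `E_N^δ := {∃ x ∈ B_N, |C^N(x)| ≥ δ|B_N|}` (`C^N(x) = {v ∈ B_N : x ↔ v inside B_N}`):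
  the box carries, ANYWHERE, an in-box open cluster of macroscopic density `δ` — the natural object of
  supercritical coarse graining (Pisztora 1996; Deuschel–Pisztora 1996; Grimmett 1999 §7.4) and, at
  `p = p_c`, of the twin cruxes `FreeBoxShattering` / `FreeBoxSparse` (stmt-4644 ≡ 5836 ≡ 4445);
* the ORIGIN-DENSITY event `A_m^t := {|C^m(0)| ≥ t|B_m|}` — the crux is `P_p(limsup_m A_m^t) > 0`.

Three registered stubs:

* STUB 1 `stub_densePieceSomeScales` (XL, OPEN at a percolating `p_c`; known for `p > p_c`): for every
  `p` with `θ(p) > 0` there are `δ, c > 0` with `P_p(E_N^δ) ≥ c` for INFINITELY MANY `N`. This is the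
  load-bearing statement and the only place the hypothesis `θ(p) > 0` is used (see DISPROOF USED). For
  `p > p_c(ℤ³)` it is Pisztora's theorem (with `c → 1`, all large `N`, any `δ < θ(p)`; Grimmett–Marstrand
  `p̂_c = p_c` underneath); at a percolating `p_c` it says "boxes are not shattered along a whole tail of
  scales". It is strictly a statement about the PHASE, not about the origin: no Harris/FKG, no ergodic
  theorem turns the crux into it or back cheaply (probes below).
* STUB 2 `stub_originShare` (M, provable now — translation averaging): for all `p`, `δ > 0`, `N`,
  `δ · P_p(E_N^δ) ≤ P_p(A_{2N}^{δ/8})`. Proof sketch: on `E_N^δ` pick `x` and `D = C^N(x)`, `|D| ≥ δ|B_N|`;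
  for every `y ∈ D`, `D ⊆ B_N ⊆ y + B_{2N}` and `y ↔ v` inside `B_N` for all `v ∈ D`, so the in-ball cluster
  of `y` at scale `2N` (centred at `y`) has `≥ δ|B_N| = δ(2N+1)³ ≥ (δ/8)(4N+1)³ = (δ/8)|B_{2N}|` vertices;
  hence `#{y ∈ B_N : τ_y A_{2N}^{δ/8}} ≥ δ|B_N|·1_{E_N^δ}` pointwise, and taking expectations with
  translation invariance of `P_p` (`bondPercolation_map_relabel_iso` with `zdShiftIso`) gives
  `|B_N| P_p(A_{2N}^{δ/8}) ≥ δ |B_N| P_p(E_N^δ)`. Needs measurability of the events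
  (`measurableSet_openConnIn`, finite sums of indicators).
* STUB 3 `stub_frequentDensityFatou` (S–M, provable now — reverse Fatou for the origin-density events):
  for all `p, t, c`: if `P_p(A_m^t) ≥ c` for infinitely many `m` then `P_p(∃ᶠ m, A_m^t) ≥ c`. Proof sketch:
  `{∃ᶠ m, A_m^t} = limsup_m A_m^t = ⋂_M ⋃_{m ≥ M} A_m^t`, continuity from above of the probability measure
  (tree: `Literature.Probability.RandomFractals.…le_measure_limsup` pattern, `tendsto_measure_iInter_atTop`)
  and `P(⋃_{m ≥ M} A_m) ≥ sup_{m ≥ M} P(A_m) ≥ c`; needs the measurability of `A_m^t` (the in-ball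
  cluster size is a finite sum of indicators of `openConnIn` events).

Composition (kernel-checked, no `sorry`): `SomeScaleDensity_of : stub 1 → stub 2 → stub 3 → SomeScaleDensity`
(hypotheses typed by the name-keyed aliases `__Registered.stub_*`, the device of
`Cruxes/NoBackbone/Lines/birth.lean` / `Cruxes/BGNOffTheFloor/Lines/birth.lean`): at a percolating `p`,
STUB 1 gives `(δ, c)` and infinitely many good scales `N`; STUB 2 and the reindexing `m = 2N`
(`frequently_originDense_of_boxGiant`, proved) give `P_p(A_m^{δ/8}) ≥ δc` for infinitely many `m`;
STUB 3 gives `P_p(∃ᶠ m, A_m^{δ/8}) ≥ δc > 0`; take `t = δ/8`.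

Neither provable stub alone, nor both, give the crux: they carry no lower bound on any probability
(STUB 2 is an inequality between two probabilities, STUB 3 a limit statement), and the hypothesis
`θ(p) > 0` enters only through STUB 1. STUB 1 alone does not give the crux by the cheap battery (it is
about SOME vertex of the box; the passage to the ORIGIN at infinitely many scales is STUB 2 + STUB 3).

DISPROOF USED. `ledger crux ls stmt-CriticalPhenomena-17919`: no `Disproof.lean`; the landed Negative lane
`Theorems/SomeScaleDensity/Negative/ThetaPosLoadBearing.lean` (refuter crux-attack at birth, p154176) is
imported and honoured: `someScaleDensity_false_without_thetaPos` (any proof must use `0 < θ(p)`: at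
`p = 0` the conclusion fails) — the line uses `H = (0 < θ(p))` at STUB 1, and ONLY there; this file
proves (i) unconditionally that STUB 1's conclusion is FALSE at `p = 0` (`boxGiantFloor_false_at_zero`:
`P_0 = δ_∅`, every in-box cluster is a singleton), so the `θ`-free strengthening of STUB 1 is refuted
exactly like the `θ`-free crux, and (ii) `not_boxGiantFloor_forall_p`: given STUBS 2–3, "STUB 1 without
`H`" contradicts the landed Negative lemma through the composition. `thetaPos_satisfiable` (`θ(1) = 1`):
the hypothesis of STUB 1 is not vacuous. Degenerate parameters: `δ ≤ 0` / `t ≤ 0` make the density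
events sure (STUB 1 asks `δ > 0`; STUB 2 asks `δ > 0`; STUB 3 is then the true `c ≤ 1` from `c ≤ P = 1`);
`N = 0` is invisible to `∃ᶠ N in atTop`; `δ > 1` makes `E_N^δ = ∅` (`|C^N(x)| ≤ |B_N|`), harmless since
STUB 1 asks `∃ δ` and STUB 2 then reads `δ · 0 ≤ P`.
Negatives index of the summit (`ledger negatives --problem CriticalPhenomena`, 11 entries): nothing on
in-box densities.

BC3 PROBES (registrar's folder `bc/probe_*.lean`, `lean check` on the farm, 2026-08-17): for each of the
three stubs `S`, `example : S → SomeScaleDensity` and `example : S → _root_.PercolationContinuityZ3` by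
`first | exact? | simpa [S] | (unfold S; simpa) | aesop` (maxHeartbeats 400000) FAIL (6/6: unsolved goals,
aesop exhaustive search failed); informational: `SomeScaleDensity → S` fails for all three (one by
heartbeat exhaustion in `exact?`), `PercolationContinuityZ3 → stub 1` fails, the JOINT cheap probe
`stub 1 → stub 2 → stub 3 → SomeScaleDensity` fails (the composition needs the witness `t = δ/8` and the
reindexing `m = 2N`), and no stub is closed stand-alone by `exact?`/`simp`/`aesop` (dedup).
-/

noncomputable section

namespace Summit.CriticalPhenomena.PercolationContinuityZ3.Cruxes.SomeScaleDensity.Birth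

open MeasureTheory Filter Literature.Probability.Percolation Literature.Probability.LatticeModels
open scoped Topology
open Summit.CriticalPhenomena.PercolationContinuityZ3.Theses.PercEventualDensity (SomeScaleDensity)
open Summit.CriticalPhenomena.PercolationContinuityZ3.Theorems.SomeScaleDensity.Negative
  (SDVConclusion someScaleDensity_iff someScaleDensity_false_without_thetaPos)

/-! ## Objects of the line -/

/-- Bond percolation `P_p` on `ℤ³`. -/
abbrev μ (p : unitInterval) : Measure (BondConfig (Site 3)) := bondPercolation (zdGraph 3) p

/-- The in-box cluster of `x` at scale `N`: `C^N(x) = {v ∈ B_N : x ↔ v inside B_N}` (`B_N = box 3 N`);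
`inBox ω m 0` is the crux's `C^m(0)` (and the Negative lane's `inBall ω m`, definitionally). -/
def inBox (ω : BondConfig (Site 3)) (N : ℕ) (x : Site 3) : Set (Site 3) :=
  {v | v ∈ box 3 N ∧ ω ∈ openConnIn (↑(box 3 N)) x v}

/-- The origin-density event `A_m^t = {t·|B_m| ≤ |C^m(0)|}`. -/
def originDense (t : ℝ) (m : ℕ) : Set (BondConfig (Site 3)) :=
  {ω | t * ((box 3 m).card : ℝ) ≤ ((inBox ω m 0).ncard : ℝ)}

/-- The box-giant event `E_N^δ = {∃ x ∈ B_N, δ·|B_N| ≤ |C^N(x)|}`: the box `B_N` carries an in-box open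
cluster of macroscopic density `δ`, anywhere in the box. -/
def boxGiant (δ : ℝ) (N : ℕ) : Set (BondConfig (Site 3)) :=
  {ω | ∃ x ∈ box 3 N, δ * ((box 3 N).card : ℝ) ≤ ((inBox ω N x).ncard : ℝ)}

/-! ## The three stub statements (spelled out over Literature declarations) -/

/-- STUB 1 statement (OPEN at a percolating `p_c`; Pisztora for `p > p_c`): in the percolating phase,
boxes carry an in-box giant with non-vanishing probability at infinitely many scales. -/
def DensePieceSomeScales : Prop :=
  ∀ p : unitInterval, 0 < theta (zdGraph 3) 0 p →
    ∃ δ : ℝ, 0 < δ ∧ ∃ c : ℝ, 0 < c ∧ ∃ᶠ N : ℕ in atTop,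
      c ≤ (bondPercolation (zdGraph 3) p).real
        {ω | ∃ x ∈ box 3 N, δ * ((box 3 N).card : ℝ) ≤
          ({v | v ∈ box 3 N ∧ ω ∈ openConnIn (↑(box 3 N)) x v}.ncard : ℝ)}

/-- STUB 2 statement (provable now; translation averaging): the origin gets its share of a box giant
one scale up — `δ · P_p(E_N^δ) ≤ P_p(A_{2N}^{δ/8})`. -/
def OriginShare : Prop :=
  ∀ (p : unitInterval) (δ : ℝ) (N : ℕ), 0 < δ →
    δ * (bondPercolation (zdGraph 3) p).real
        {ω | ∃ x ∈ box 3 N, δ * ((box 3 N).card : ℝ) ≤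
          ({v | v ∈ box 3 N ∧ ω ∈ openConnIn (↑(box 3 N)) x v}.ncard : ℝ)}
      ≤ (bondPercolation (zdGraph 3) p).real
        {ω | δ / 8 * ((box 3 (2 * N)).card : ℝ) ≤
          ({v | v ∈ box 3 (2 * N) ∧ ω ∈ openConnIn (↑(box 3 (2 * N))) 0 v}.ncard : ℝ)}

/-- STUB 3 statement (provable now; reverse Fatou for the origin-density events, including their
measurability): a probability floor at infinitely many scales passes to the event "dense at
infinitely many scales". -/
def FrequentDensityFatou : Prop :=
  ∀ (p : unitInterval) (t c : ℝ),
    (∃ᶠ m : ℕ in atTop, c ≤ (bondPercolation (zdGraph 3) p).real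
        {ω | t * ((box 3 m).card : ℝ) ≤
          ({v | v ∈ box 3 m ∧ ω ∈ openConnIn (↑(box 3 m)) 0 v}.ncard : ℝ)}) →
    c ≤ (bondPercolation (zdGraph 3) p).real
        {ω | ∃ᶠ m : ℕ in atTop, t * ((box 3 m).card : ℝ) ≤
          ({v | v ∈ box 3 m ∧ ω ∈ openConnIn (↑(box 3 m)) 0 v}.ncard : ℝ)}

/-- `DensePieceSomeScales` in the local vocabulary. -/
theorem densePieceSomeScales_iff :
    DensePieceSomeScales ↔ ∀ p : unitInterval, 0 < theta (zdGraph 3) 0 p →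
      ∃ δ : ℝ, 0 < δ ∧ ∃ c : ℝ, 0 < c ∧ ∃ᶠ N : ℕ in atTop, c ≤ (μ p).real (boxGiant δ N) := Iff.rfl

/-- `OriginShare` in the local vocabulary. -/
theorem originShare_iff :
    OriginShare ↔ ∀ (p : unitInterval) (δ : ℝ) (N : ℕ), 0 < δ →
      δ * (μ p).real (boxGiant δ N) ≤ (μ p).real (originDense (δ / 8) (2 * N)) := Iff.rfl

/-- `FrequentDensityFatou` in the local vocabulary. -/
theorem frequentDensityFatou_iff :
    FrequentDensityFatou ↔ ∀ (p : unitInterval) (t c : ℝ),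
      (∃ᶠ m : ℕ in atTop, c ≤ (μ p).real (originDense t m)) →
        c ≤ (μ p).real {ω | ∃ᶠ m : ℕ in atTop, ω ∈ originDense t m} := Iff.rfl

/-- The crux's conclusion at `p` (the Negative lane's `SDVConclusion p`) in the local vocabulary. -/
theorem sdvConclusion_iff (p : unitInterval) :
    SDVConclusion p ↔ ∃ t : ℝ, 0 < t ∧ 0 < (μ p).real {ω | ∃ᶠ m : ℕ in atTop, ω ∈ originDense t m} :=
  Iff.rfl

/-! ## Registered stubs (the only `sorry`s of the file) -/

/-- **STUB 1 `densePieceSomeScales`** (XL, OPEN at a percolating `p_c`): for every `p` with `θ(p) > 0`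
there are `δ > 0`, `c > 0` such that for infinitely many `N`,
`P_p(∃ x ∈ B_N, |{v ∈ B_N : x ↔ v inside B_N}| ≥ δ|B_N|) ≥ c`.
Why plausibly true: for `p > p_c(ℤ³)` it is Pisztora's coarse-graining theorem (largest in-box cluster
has density `→ θ(p)` in probability; Grimmett–Marstrand `p̂_c = p_c`), so its content is the
hypothetical percolating `p = p_c`, where it denies shattering along a tail of scales. Why it might
fail: a shattered jump world (dense unique infinite cluster whose in-box pieces are all sparse)
violates it, exactly as it violates the crux; the same-`p` two-arm route of Cerf reaches only
polynomially inflated boxes. Uses `H = (0 < θ(p))` (load-bearing: `boxGiantFloor_false_at_zero`). -/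
theorem stub_densePieceSomeScales :
    ∀ p : unitInterval, 0 < theta (zdGraph 3) 0 p →
      ∃ δ : ℝ, 0 < δ ∧ ∃ c : ℝ, 0 < c ∧ ∃ᶠ N : ℕ in atTop,
        c ≤ (bondPercolation (zdGraph 3) p).real
          {ω | ∃ x ∈ box 3 N, δ * ((box 3 N).card : ℝ) ≤
            ({v | v ∈ box 3 N ∧ ω ∈ openConnIn (↑(box 3 N)) x v}.ncard : ℝ)} := by
  sorry

/-- **STUB 2 `originShare`** (M, provable now): for all `p`, `δ > 0`, `N`,
`δ · P_p(∃ x ∈ B_N, |C^N(x)| ≥ δ|B_N|) ≤ P_p(|C^{2N}(0)| ≥ (δ/8)|B_{2N}|)`.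
Why true: on the box-giant event every vertex `y` of the dense piece `D = C^N(x)` (`|D| ≥ δ|B_N|`) sees
`D ⊆ B_N ⊆ y + B_{2N}` joined to `y` inside `B_N`, so `y`'s own in-ball cluster at scale `2N` has
`≥ δ(2N+1)³ ≥ (δ/8)(4N+1)³` vertices; sum the indicators over `y ∈ B_N`, take expectations and use the
translation invariance of `P_p` (`bondPercolation_map_relabel_iso`, `zdShiftIso`). -/
theorem stub_originShare :
    ∀ (p : unitInterval) (δ : ℝ) (N : ℕ), 0 < δ →
      δ * (bondPercolation (zdGraph 3) p).real
          {ω | ∃ x ∈ box 3 N, δ * ((box 3 N).card : ℝ) ≤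
            ({v | v ∈ box 3 N ∧ ω ∈ openConnIn (↑(box 3 N)) x v}.ncard : ℝ)}
        ≤ (bondPercolation (zdGraph 3) p).real
          {ω | δ / 8 * ((box 3 (2 * N)).card : ℝ) ≤
            ({v | v ∈ box 3 (2 * N) ∧ ω ∈ openConnIn (↑(box 3 (2 * N))) 0 v}.ncard : ℝ)} := by
  sorry

/-- **STUB 3 `frequentDensityFatou`** (S–M, provable now): for all `p, t, c`, if
`P_p(|C^m(0)| ≥ t|B_m|) ≥ c` for infinitely many `m` then `P_p(|C^m(0)| ≥ t|B_m| for infinitely many m) ≥ c`.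
Why true: `{∃ᶠ m, A_m} = ⋂_M ⋃_{m ≥ M} A_m`, continuity from above of the probability measure and
`P(⋃_{m ≥ M} A_m) ≥ c` for every `M`; the events are measurable (`|C^m(0)|` is a finite sum of indicators
of `openConnIn` events, `measurableSet_openConnIn`). Pattern: `le_measure_limsup`
(Literature/Probability/RandomFractals/SecondMomentDimension). -/
theorem stub_frequentDensityFatou :
    ∀ (p : unitInterval) (t c : ℝ),
      (∃ᶠ m : ℕ in atTop, c ≤ (bondPercolation (zdGraph 3) p).real
          {ω | t * ((box 3 m).card : ℝ) ≤
            ({v | v ∈ box 3 m ∧ ω ∈ openConnIn (↑(box 3 m)) 0 v}.ncard : ℝ)}) →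
      c ≤ (bondPercolation (zdGraph 3) p).real
          {ω | ∃ᶠ m : ℕ in atTop, t * ((box 3 m).card : ℝ) ≤
            ({v | v ∈ box 3 m ∧ ω ∈ openConnIn (↑(box 3 m)) 0 v}.ncard : ℝ)} := by
  sorry

/-! ### Name-keyed aliases of the stub statements
`__Registered.stub_X` is the statement of `stub_X` under the registered stub's short name, so that the
native skeleton audit (`#h21_check_skeleton`: hypotheses admissible iff registered obligations / declared
stubs BY NAME) accepts `SomeScaleDensity_of : __Registered.stub_… → … → SomeScaleDensity` (device of
`Cruxes/NoBackbone/Lines/birth.lean`; the `@[stub]` attribute is gate-reserved). -/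
namespace __Registered

/-- Alias of `DensePieceSomeScales` keyed by the registered stub name. -/
abbrev stub_densePieceSomeScales : Prop := DensePieceSomeScales
/-- Alias of `OriginShare` keyed by the registered stub name. -/
abbrev stub_originShare : Prop := OriginShare
/-- Alias of `FrequentDensityFatou` keyed by the registered stub name. -/
abbrev stub_frequentDensityFatou : Prop := FrequentDensityFatou

end __Registered

/-! ## Proved plumbing -/

/-- **Reindexing `m = 2N`**: from a probability floor `c` for the box giant at infinitely many scales
`N` and the origin-share inequality, a floor `δ c` for the origin-density event `A_m^{δ/8}` at
infinitely many scales `m`. -/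
theorem frequently_originDense_of_boxGiant (hB : OriginShare) {p : unitInterval} {δ c : ℝ}
    (hδ : 0 < δ) (h : ∃ᶠ N : ℕ in atTop, c ≤ (μ p).real (boxGiant δ N)) :
    ∃ᶠ m : ℕ in atTop, δ * c ≤ (μ p).real (originDense (δ / 8) m) := by
  rw [Filter.frequently_atTop] at h ⊢
  intro M
  obtain ⟨N, hNM, hN⟩ := h M
  refine ⟨2 * N, by omega, ?_⟩
  calc δ * c ≤ δ * (μ p).real (boxGiant δ N) := mul_le_mul_of_nonneg_left hN hδ.le
    _ ≤ (μ p).real (originDense (δ / 8) (2 * N)) := (originShare_iff.1 hB) p δ N hδ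

/-- **The core of the composition at one parameter**: STUBS 2–3 turn a box-giant floor at infinitely
many scales into the crux's conclusion at `p` (`SDVConclusion p`), with `t = δ/8` and probability
`≥ δ c > 0`. No hypothesis on `θ(p)` here. -/
theorem sdvConclusion_of_boxGiantFloor (hB : OriginShare) (hC : FrequentDensityFatou)
    {p : unitInterval} {δ c : ℝ} (hδ : 0 < δ) (hc : 0 < c)
    (h : ∃ᶠ N : ℕ in atTop, c ≤ (μ p).real (boxGiant δ N)) : SDVConclusion p := by
  rw [sdvConclusion_iff]
  refine ⟨δ / 8, by positivity, ?_⟩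
  have h2 : ∃ᶠ m : ℕ in atTop, δ * c ≤ (μ p).real (originDense (δ / 8) m) :=
    frequently_originDense_of_boxGiant hB hδ h
  have h3 : δ * c ≤ (μ p).real {ω | ∃ᶠ m : ℕ in atTop, ω ∈ originDense (δ / 8) m} :=
    (frequentDensityFatou_iff.1 hC) p (δ / 8) (δ * c) h2
  exact lt_of_lt_of_le (mul_pos hδ hc) h3

/-! ## The composition, by name -/

/-- **`SomeScaleDensity_of`**: the three registered stubs imply the crux
`Summit.CriticalPhenomena.PercolationContinuityZ3.Theses.PercEventualDensity.SomeScaleDensity`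
(kernel-checked; no `sorry` outside the stubs). Proof: at a percolating `p`, STUB 1 gives `δ, c > 0` and
infinitely many scales `N` with `P_p(E_N^δ) ≥ c`; `sdvConclusion_of_boxGiantFloor` (STUB 2, reindexing
`m = 2N`, STUB 3) gives `P_p(∃ᶠ m, |C^m(0)| ≥ (δ/8)|B_m|) ≥ δ c > 0`. -/
theorem SomeScaleDensity_of (hA : __Registered.stub_densePieceSomeScales)
    (hB : __Registered.stub_originShare) (hC : __Registered.stub_frequentDensityFatou) :
    Summit.CriticalPhenomena.PercolationContinuityZ3.Theses.PercEventualDensity.SomeScaleDensity := by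
  rw [someScaleDensity_iff]
  intro p hp
  obtain ⟨δ, hδ, c, hc, hfreq⟩ := (densePieceSomeScales_iff.1 hA) p hp
  exact sdvConclusion_of_boxGiantFloor hB hC hδ hc hfreq

/-- Wiring check: the registered stubs feed `SomeScaleDensity_of` as stated (an `example`, so no
`sorry`-tainted proof of the crux enters the environment under a name). -/
example : Summit.CriticalPhenomena.PercolationContinuityZ3.Theses.PercEventualDensity.SomeScaleDensity :=
  SomeScaleDensity_of stub_densePieceSomeScales stub_originShare stub_frequentDensityFatou

/-! ## Honest-piece checks: the hypothesis `0 < θ(p)` is load-bearing in STUB 1 (DISPROOF USED) -/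

/-- In the empty configuration every in-box cluster is a singleton (as a subset). -/
theorem inBox_empty_subset (N : ℕ) (x : Site 3) : inBox (∅ : BondConfig (Site 3)) N x ⊆ {x} := by
  intro v hv
  obtain ⟨-, hx, hy, hreach⟩ := hv
  have hbot : (openGraph (∅ : BondConfig (Site 3))).induce (↑(box 3 N) : Set (Site 3)) = ⊥ := by
    ext a b
    simp [openGraph_adj]
  rw [hbot, SimpleGraph.reachable_bot] at hreach
  have := congrArg Subtype.val hreach
  simpa using this.symm

/-- Hence `|C^N(x)| ≤ 1` in the empty configuration. -/
theorem ncard_inBox_empty_le (N : ℕ) (x : Site 3) : (inBox (∅ : BondConfig (Site 3)) N x).ncard ≤ 1 :=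
  calc (inBox (∅ : BondConfig (Site 3)) N x).ncard ≤ ({x} : Set (Site 3)).ncard :=
        Set.ncard_le_ncard (inBox_empty_subset N x) (Set.finite_singleton x)
    _ = 1 := Set.ncard_singleton x

/-- The empty configuration carries no box giant once `δ|B_N| > 1`. -/
theorem empty_notMem_boxGiant {δ : ℝ} {N : ℕ} (hN : 1 < δ * ((box 3 N).card : ℝ)) :
    (∅ : BondConfig (Site 3)) ∉ boxGiant δ N := by
  rintro ⟨x, -, hx⟩
  have h1 : ((inBox (∅ : BondConfig (Site 3)) N x).ncard : ℝ) ≤ 1 := by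
    exact_mod_cast ncard_inBox_empty_le N x
  linarith

/-- For `δ > 0`, eventually `δ|B_N| > 1`. -/
theorem eventually_one_lt_mul_card_box {δ : ℝ} (hδ : 0 < δ) :
    ∀ᶠ N : ℕ in atTop, 1 < δ * ((box 3 N).card : ℝ) := by
  refine Filter.eventually_atTop.2 ⟨⌈1 / δ⌉₊ + 1, fun N hN => ?_⟩
  have hN' : (1 / δ : ℝ) < N := by
    have h1 : (1 / δ : ℝ) ≤ ⌈1 / δ⌉₊ := Nat.le_ceil _
    have h2 : ((⌈1 / δ⌉₊ + 1 : ℕ) : ℝ) ≤ N := by exact_mod_cast hN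
    push_cast at h2
    linarith
  have hcard : (N : ℝ) ≤ ((box 3 N).card : ℝ) := by
    rw [card_box]
    have : N ≤ (2 * N + 1) ^ 3 := le_trans (by omega) (Nat.le_self_pow (by norm_num) (2 * N + 1))
    exact_mod_cast this
  rw [div_lt_iff₀ hδ] at hN'
  calc (1 : ℝ) < N * δ := hN'
    _ = δ * N := mul_comm _ _
    _ ≤ δ * ((box 3 N).card : ℝ) := mul_le_mul_of_nonneg_left hcard hδ.le

/-- **STUB 1's conclusion is FALSE at `p = 0`** (`P_0 = δ_∅`): so STUB 1 without its hypothesis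
`0 < θ(p)` is refuted exactly like the `θ`-free crux (`someScaleDensity_false_without_thetaPos`) — the
line uses `H = (0 < θ(p))` at STUB 1. -/
theorem boxGiantFloor_false_at_zero :
    ¬ ∃ δ : ℝ, 0 < δ ∧ ∃ c : ℝ, 0 < c ∧ ∃ᶠ N : ℕ in atTop, c ≤ (μ 0).real (boxGiant δ N) := by
  rintro ⟨δ, hδ, c, hc, hfreq⟩
  have hμ : μ 0 = Measure.dirac (∅ : BondConfig (Site 3)) := by
    show bondPercolation (zdGraph 3) 0 = _
    rw [bondPercolation]
    exact ProbabilityTheory.setBernoulli_zero _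
  obtain ⟨N, hcN, h1N⟩ := (hfreq.and_eventually (eventually_one_lt_mul_card_box hδ)).exists
  have hzero : (μ 0).real (boxGiant δ N) = 0 := by
    rw [hμ, measureReal_def, Measure.dirac_apply, Set.indicator_of_notMem (empty_notMem_boxGiant h1N),
      ENNReal.toReal_zero]
  linarith

/-- The `θ`-free strengthening of STUB 1 is false (instance `p = 0`). -/
theorem not_densePiece_without_thetaPos :
    ¬ ∀ p : unitInterval, ∃ δ : ℝ, 0 < δ ∧ ∃ c : ℝ, 0 < c ∧
        ∃ᶠ N : ℕ in atTop, c ≤ (μ p).real (boxGiant δ N) :=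
  fun h => boxGiantFloor_false_at_zero (h 0)

/-- Second route to the same conclusion, through the landed Negative lemma: given STUBS 2–3, the
`θ`-free STUB 1 would prove the `θ`-free crux, which `someScaleDensity_false_without_thetaPos` refutes. -/
theorem not_densePiece_without_thetaPos' (hB : __Registered.stub_originShare)
    (hC : __Registered.stub_frequentDensityFatou) :
    ¬ ∀ p : unitInterval, ∃ δ : ℝ, 0 < δ ∧ ∃ c : ℝ, 0 < c ∧
        ∃ᶠ N : ℕ in atTop, c ≤ (μ p).real (boxGiant δ N) := by
  intro h
  refine someScaleDensity_false_without_thetaPos fun p => ?_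
  obtain ⟨δ, hδ, c, hc, hfreq⟩ := h p
  exact sdvConclusion_of_boxGiantFloor hB hC hδ hc hfreq

/-! ## Honest-piece checks (informative): elementary relations between the events -/

/-- The origin-density event implies the box-giant event at the same scale and density (`x = 0`). -/
theorem originDense_subset_boxGiant (t : ℝ) (m : ℕ) : originDense t m ⊆ boxGiant t m :=
  fun _ hω => ⟨0, zero_mem_box 3 m, hω⟩

/-- Hence `P_p(A_m^t) ≤ P_p(E_m^t)`: a floor for the ORIGIN at infinitely many scales gives STUB 1's
conclusion at that `p` for free — the content of STUB 1 beyond the crux's neighbourhood is the freedom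
of `x`, which STUB 2 converts back at the price `δ ↦ δ/8`, one scale up. -/
theorem real_originDense_le_boxGiant (p : unitInterval) (t : ℝ) (m : ℕ) :
    (μ p).real (originDense t m) ≤ (μ p).real (boxGiant t m) :=
  measureReal_mono (originDense_subset_boxGiant t m)

end Summit.CriticalPhenomena.PercolationContinuityZ3.Cruxes.SomeScaleDensity.Birth

end
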